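import Literature.NumberTheory.Automorphic.UnitaryGroupLocalFactors
import Literature.NumberTheory.Automorphic.AdeleBaseChange
import Mathlib.Topology.Algebra.Module.FiniteDimension
import Mathlib.FieldTheory.Perfect
import Mathlib.FieldTheory.Galois.Basic
import HarnessLib

/-!
# Local base change `E ⊗_F F_v = ∏_{w ∣ v} E_w`: the `F_v`-algebra structure, weak approximation,
and the quadratic case `E_v = F_v ⊕ F_v δ`
(Cassels–Fröhlich, *Algebraic Number Theory* (1967), Ch. II §§10–11 (`L ⊗_K K_v ≅ ∏_{w ∣ v} L_w`), §6
(approximation theorem); Neukirch, *Algebraic Number Theory* (1999), Ch. II (3.4), (8.3))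

Topic `NumberTheory/Automorphic`; namespace `Literature.NumberTheory.Automorphic.UnitaryGroup` (the home of the
tree's `LocalRing E v = ∏_{w ∣ v} E_w`). Definitions and proved lemmas only: **no named facts, 0 proof holes**.

**Setting.** `E/F` number fields, `v` a finite place of `F`; `UnitaryGroup.PlacesOver E v` the (finite, non-empty)
type of places `w ∣ v` of `E` and `UnitaryGroup.LocalRing E v = Π_{w ∣ v} E_w` (tree, `UnitaryGroupAutomorphicRep`),
the model of `E ⊗_F F_v` used by the adelic unitary groups of this topic. This file supplies what that model was
missing:

* §1 the structure map `ι_v : F_v →+* ∏_{w ∣ v} E_w` (`toLocalRing`, componentwise the tree's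
  `adicCompletionOfLiesOver`), making `LocalRing E v` a topological `F_v`-algebra (`instance`s `Algebra`,
  `ContinuousSMul`, `IsScalarTower F F_v (LocalRing E v)`), with `ι_v` continuous and injective;
* §2 **weak approximation at the places above `v`**: `E` is dense in `∏_{w ∣ v} E_w`
  (`denseRange_algebraMap_localRing`; Chinese remainder theorem `IsDedekindDomain.exists_forall_sub_mem_ideal` for
  the idempotents + Mathlib's density of `E` in each `E_w`);
* §3 the conjugation `σ ⊗ 1` (`conjLocal`, tree) is `F_v`-linear: it fixes `ι_v(F_v)` and acts as `σ` on `E`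
  (`conjLocal_toLocalRing`, `conjLocal_algebraMap`);
* §4 **the quadratic case**: for `σ ∈ Aut(E/F)` and `δ ∈ E` with `σ δ = -δ ≠ 0` (so `E = F(δ)` is quadratic, e.g. `E`
  CM, `F = E⁺`, `σ` = complex conjugation, `δ² ∈ F` totally negative), the `F_v`-linear map
  `Ψ_v : F_v × F_v → ∏_{w ∣ v} E_w`, `(a, b) ↦ ι_v a + ι_v b · δ` is injective (apply `σ ⊗ 1`), and for
  `[Algebra.IsQuadraticExtension F E]` it is surjective (its range is a closed `F_v`-subspace containing the dense
  image of `E = F ⊕ F δ`): **`quadraticLocalEquiv : (F_v × F_v) ≃L[F_v] ∏_{w ∣ v} E_w`**, i.e.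
  `E ⊗_F F_v = F_v ⊕ F_v δ` is free of rank `2 = [E : F]` over `F_v` with basis `(1, δ)` — the local degree
  formula `∑_{w ∣ v} [E_w : F_v] = [E : F]` in the quadratic case, proved here without ramification theory;
  parameter-free: `instance isQuadraticExtension_localRing : Algebra.IsQuadraticExtension F_v (∏_{w ∣ v} E_w)`
  (`exists_algEquiv_apply_eq_neg` produces `σ, δ` from `[Algebra.IsQuadraticExtension F E]`), and the action of
  `σ ⊗ 1` and of `δ` in the coordinates `(a, b)` (`conjLocal_quadraticLocalEquiv`, `algebraMap_mul_quadraticLocalEquiv`).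

## Mathlib / tree

Mathlib: `IsDedekindDomain.HeightOneSpectrum.adicCompletion` (+ `denseRange_algebraMap`, `valuedAdicCompletion_eq_valuation'`,
`valuation_exists_uniformizer`, `intValuation_le_pow_iff_mem`), `IsDedekindDomain.exists_forall_sub_mem_ideal`,
`Valued.mem_nhds`, `Submodule.closed_of_finiteDimensional`, `LinearEquiv.toContinuousLinearEquiv`,
`Algebra.IsQuadraticExtension` (+ `isGalois`, `IsGalois.card_aut_eq_finrank`); Mathlib has the archimedean analogue of §1 (`NumberField.LiesOver` scoped instances
for infinite places) but neither the finite-place algebra structure nor `L ⊗_K K_v ≅ ∏ L_w` in any case. Tree: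
`AdeleBaseChange` (`adicCompletionOfLiesOver` and its `coe`/continuity/valuation lemmas), `UnitaryGroupAutomorphicRep`
(`PlacesOver`, `LocalRing`, `conjLocal`), `UnitaryGroupLocalFactors` (`Fintype (PlacesOver E v)`), `GaloisActionPlaces`
(`galAdicCompletionMap`, `adicCompletion.ext_of_coe`).

## Provenance

Written under the LEAN-IN-TREE rule (2026-08-18) for the pub-hodgecm formalisation cell (model-construction sub-cell,
base-change junction): the identification of the carriers `GL_n(E ⊗_F F_v)` of that cell's local unitary groups with
`F_v`-points. Nothing in this file is a claim of the manuscripts adjudicated by that cell.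

## References

* J. W. S. Cassels, A. Fröhlich (eds.), *Algebraic Number Theory* (1967), Ch. II §6 (approximation), §§10–11
  (`L ⊗_K K_v ≅ ∏_{w ∣ v} L_w`) [CasselsFrohlichANT1967].
* J. Neukirch, *Algebraic Number Theory*, Grundlehren 322 (1999), Ch. II (3.4), (8.3) [Neukirch1999].
-/

noncomputable section

open NumberField IsDedekindDomain Topology Filter

namespace Literature.NumberTheory.Automorphic

namespace UnitaryGroup

variable {F : Type} (E : Type) [Field F] [NumberField F] [Field E] [NumberField E] [Algebra F E]

/-! ## 1. `∏_{w ∣ v} E_w` as a topological `F_v`-algebra -/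

section Structure

variable {E} in
omit [NumberField F] [NumberField E] in
/-- A place above `v` lies over `v` (`Ideal.LiesOver` form, keys the tree's `adicCompletionOfLiesOver`). [folklore] -/
theorem PlacesOver.liesOver {v : HeightOneSpectrum (𝓞 F)} (w : PlacesOver E v) :
    w.1.asIdeal.LiesOver v.asIdeal :=
  ⟨congrArg HeightOneSpectrum.asIdeal w.2.symm⟩

/-- There is a place of `E` above every finite place `v` of `F` (going up). [folklore] -/
instance PlacesOver.nonempty (v : HeightOneSpectrum (𝓞 F)) : Nonempty (PlacesOver E v) := by
  obtain ⟨Q, hQ, hQv⟩ := Ideal.exists_maximal_ideal_liesOver_of_isIntegral (S := 𝓞 E) v.asIdeal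
  have hQ0 : Q ≠ ⊥ := Ideal.ne_bot_of_liesOver_of_ne_bot v.ne_bot Q
  exact ⟨⟨⟨Q, hQ.isPrime, hQ0⟩, HeightOneSpectrum.ext hQv.over.symm⟩⟩

variable {E} in
/-- **The local structure map at a place above `v`**: `ι_w : F_v →+* E_w` for `w ∣ v` (the tree's
`adicCompletionOfLiesOver`). [folklore] -/
def toPlace (v : HeightOneSpectrum (𝓞 F)) (w : PlacesOver E v) :
    v.adicCompletion F →+* w.1.adicCompletion E :=
  haveI := PlacesOver.liesOver w
  adicCompletionOfLiesOver F E v w.1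

variable {E} in
/-- `ι_w` extends `F → E`. [folklore] -/
@[simp] theorem toPlace_coe (v : HeightOneSpectrum (𝓞 F)) (w : PlacesOver E v) (x : F) :
    toPlace v w (x : v.adicCompletion F) = ((algebraMap F E x : E) : w.1.adicCompletion E) :=
  haveI := PlacesOver.liesOver w
  adicCompletionOfLiesOver_coe F E v w.1 x

variable {E} in
/-- `ι_w` is continuous. [folklore] -/
theorem continuous_toPlace (v : HeightOneSpectrum (𝓞 F)) (w : PlacesOver E v) : Continuous (toPlace v w) :=
  haveI := PlacesOver.liesOver w
  continuous_adicCompletionOfLiesOver F E v w.1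

variable {E} in
/-- `v_w(ι_w y) = v_v(y)^{e(w|v)}`. [folklore] -/
theorem valued_toPlace (v : HeightOneSpectrum (𝓞 F)) (w : PlacesOver E v) (y : v.adicCompletion F) :
    Valued.v (toPlace v w y) = Valued.v y ^ v.asIdeal.ramificationIdx' w.1.asIdeal :=
  haveI := PlacesOver.liesOver w
  valued_adicCompletionOfLiesOver F E v w.1 y

variable {E} in
/-- `ι_w(𝒪_v) ⊆ 𝒪_w`. [folklore] -/
theorem toPlace_mem_adicCompletionIntegers (v : HeightOneSpectrum (𝓞 F)) (w : PlacesOver E v)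
    {y : v.adicCompletion F} (hy : y ∈ v.adicCompletionIntegers F) :
    toPlace v w y ∈ w.1.adicCompletionIntegers E :=
  haveI := PlacesOver.liesOver w
  adicCompletionOfLiesOver_mem_adicCompletionIntegers F E v w.1 hy

/-- **The structure map `ι_v : F_v →+* E ⊗_F F_v = ∏_{w ∣ v} E_w`**, `(ι_v a)_w = ι_w a`. [folklore] -/
def toLocalRing (v : HeightOneSpectrum (𝓞 F)) : v.adicCompletion F →+* LocalRing E v :=
  RingHom.pi fun w => toPlace v w

/-- Components of `ι_v` (definitional). [folklore] -/
@[simp] theorem toLocalRing_apply (v : HeightOneSpectrum (𝓞 F)) (a : v.adicCompletion F) (w : PlacesOver E v) :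
    toLocalRing E v a w = toPlace v w a := rfl

/-- `ι_v` extends `F → E → ∏ E_w`. [folklore] -/
theorem toLocalRing_coe (v : HeightOneSpectrum (𝓞 F)) (x : F) :
    toLocalRing E v (x : v.adicCompletion F) = algebraMap E (LocalRing E v) (algebraMap F E x) :=
  funext fun w => toPlace_coe v w x

/-- `ι_v` is continuous. [folklore] -/
theorem continuous_toLocalRing (v : HeightOneSpectrum (𝓞 F)) : Continuous (toLocalRing E v) :=
  continuous_pi fun w => continuous_toPlace v w

/-- `∏_{w ∣ v} E_w` is a nontrivial ring (there is a place above `v`). [folklore] -/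
instance nontrivial_localRing (v : HeightOneSpectrum (𝓞 F)) : Nontrivial (LocalRing E v) :=
  (PlacesOver.nonempty E v).elim fun w => Pi.nontrivial_at w

/-- `ι_v` is injective. [folklore] -/
theorem toLocalRing_injective (v : HeightOneSpectrum (𝓞 F)) : Function.Injective (toLocalRing E v) :=
  (toLocalRing E v).injective

/-- `ι_v(𝒪_v) ⊆ ∏ 𝒪_w`. [folklore] -/
theorem toLocalRing_mem_adicCompletionIntegers (v : HeightOneSpectrum (𝓞 F)) {y : v.adicCompletion F}
    (hy : y ∈ v.adicCompletionIntegers F) (w : PlacesOver E v) :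
    toLocalRing E v y w ∈ w.1.adicCompletionIntegers E :=
  toPlace_mem_adicCompletionIntegers v w hy

/-- **`∏_{w ∣ v} E_w` is an `F_v`-algebra** through `ι_v`. (There is no competing instance: Mathlib has no
`F_v`-algebra structure on the `E_w` at finite places.) [folklore] -/
instance algebraLocalRing (v : HeightOneSpectrum (𝓞 F)) : Algebra (v.adicCompletion F) (LocalRing E v) :=
  (toLocalRing E v).toAlgebra

/-- The structure map is `ι_v` (definitional). [folklore] -/
theorem algebraMap_localRing_eq (v : HeightOneSpectrum (𝓞 F)) :
    algebraMap (v.adicCompletion F) (LocalRing E v) = toLocalRing E v := rfl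

/-- `F → F_v → ∏ E_w` is `F → E → ∏ E_w`. [folklore] -/
instance isScalarTower_localRing (v : HeightOneSpectrum (𝓞 F)) :
    IsScalarTower F (v.adicCompletion F) (LocalRing E v) :=
  IsScalarTower.of_algebraMap_eq fun x => by
    funext w
    change ((algebraMap F E x : E) : w.1.adicCompletion E) = toPlace v w (x : v.adicCompletion F)
    rw [toPlace_coe]

/-- The scalar multiplication by `F_v` on `∏ E_w` is continuous. [folklore] -/
instance continuousSMul_localRing (v : HeightOneSpectrum (𝓞 F)) :
    ContinuousSMul (v.adicCompletion F) (LocalRing E v) :=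
  continuousSMul_of_algebraMap _ _ (continuous_toLocalRing E v)

/-- `a • x = ι_v a * x` (definitional). [folklore] -/
theorem smul_localRing_def (v : HeightOneSpectrum (𝓞 F)) (a : v.adicCompletion F) (x : LocalRing E v) :
    a • x = toLocalRing E v a * x := Algebra.smul_def a x

end Structure

/-! ## 2. Weak approximation: `E` is dense in `∏_{w ∣ v} E_w` -/

section WeakApproximation

variable {E}

/-- An open ball `{y | v(y - x) < v(π)}` (`π ≠ 0`) is a neighbourhood of `x` in `E_w`. [folklore] -/
theorem ball_mem_nhds (w : HeightOneSpectrum (𝓞 E)) (x π : w.adicCompletion E) (hπ : Valued.v π ≠ 0) :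
    {y : w.adicCompletion E | Valued.v (y - x) < Valued.v π} ∈ 𝓝 x := by
  refine Valued.mem_nhds.mpr ⟨Units.mk0 (Valued.v.restrict π) ?_, fun y hy => ?_⟩
  · exact ((Valuation.restrict_pos_iff (v := Valued.v) π).mpr (zero_lt_iff.mpr hπ)).ne'
  · simp only [Set.mem_setOf_eq, Units.val_mk0] at hy ⊢
    exact (Valuation.restrict_lt_iff _).mp hy

/-- A neighbourhood of `x` in `E_w` contains a ball `{y | v(y - x) < q_w^{-n}}`. [folklore] -/
theorem exists_exp_lt_of_mem_nhds (w : HeightOneSpectrum (𝓞 E)) {x : w.adicCompletion E}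
    {t : Set (w.adicCompletion E)} (ht : t ∈ 𝓝 x) :
    ∃ n : ℕ, ∀ y, Valued.v (y - x) < WithZero.exp (-(n : ℤ)) → y ∈ t := by
  obtain ⟨γ, hγ⟩ := Valued.mem_nhds.mp ht
  set emb : MonoidWithZeroHom.ValueGroup₀ (MonoidWithZeroHom.ofClass
      (Valued.v : Valuation (w.adicCompletion E) (WithZero (Multiplicative ℤ)))) →*₀
        WithZero (Multiplicative ℤ) :=
    MonoidWithZeroHom.ValueGroup₀.embedding with hemb
  set g : WithZero (Multiplicative ℤ) := emb γ.1 with hg_def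
  have hg0 : g ≠ 0 := by
    intro h
    apply γ.ne_zero
    apply (MonoidWithZeroHom.ValueGroup₀.embedding_strictMono (f := MonoidWithZeroHom.ofClass
      (Valued.v : Valuation (w.adicCompletion E) (WithZero (Multiplicative ℤ))))).injective
    rw [map_zero]
    exact h
  obtain ⟨n, hn⟩ : ∃ n : ℕ, WithZero.exp (-(n : ℤ)) < g := by
    refine ⟨(1 - WithZero.log g).toNat, ?_⟩
    conv_rhs => rw [← WithZero.exp_log hg0]
    rw [WithZero.exp_lt_exp]
    omega
  refine ⟨n, fun y hy => hγ ?_⟩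
  simp only [Set.mem_setOf_eq]
  rw [Valuation.restrict_lt_iff_lt_embedding]
  change _ < g
  exact lt_trans hy hn

/-- Exponent bookkeeping in `ℤₘ₀`: finitely many `a` are beaten by a common `q^{-m}`:
`a · exp(-m) < exp(-n)`. [folklore] -/
theorem exists_mul_exp_neg_lt (S : Finset (WithZero (Multiplicative ℤ))) (n : ℕ) :
    ∃ m : ℕ, ∀ a ∈ S, a * WithZero.exp (-(m : ℤ)) < WithZero.exp (-(n : ℤ)) := by
  refine ⟨S.sup fun a => (WithZero.log a + n + 1).toNat, fun a ha => ?_⟩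
  rcases eq_or_ne a 0 with rfl | ha0
  · rw [zero_mul]; exact WithZero.exp_pos
  · have hle : (WithZero.log a + n + 1).toNat ≤ S.sup (fun a => (WithZero.log a + n + 1).toNat) :=
      Finset.le_sup (f := fun a => (WithZero.log a + (n : ℤ) + 1).toNat) ha
    conv_lhs => rw [← WithZero.exp_log ha0]
    rw [← WithZero.exp_add, WithZero.exp_lt_exp]
    omega

/-- **Chinese-remainder idempotents**: for `w₀ ∣ v` and `m`, an algebraic integer `y ∈ 𝓞_E` with
`y ≡ 1 (mod 𝔭_{w₀}^m)` and `y ≡ 0 (mod 𝔭_w^m)` for the other `w ∣ v`, read in the completions. [folklore] -/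
theorem exists_integer_near_indicator (v : HeightOneSpectrum (𝓞 F)) (w₀ : PlacesOver E v) (m : ℕ) :
    ∃ y : 𝓞 E,
      Valued.v (algebraMap E (w₀.1.adicCompletion E) (algebraMap (𝓞 E) E y) - 1) ≤ WithZero.exp (-(m : ℤ)) ∧
        ∀ w : PlacesOver E v, w ≠ w₀ →
          Valued.v (algebraMap E (w.1.adicCompletion E) (algebraMap (𝓞 E) E y)) ≤ WithZero.exp (-(m : ℤ)) := by
  classical
  obtain ⟨y, hy⟩ := IsDedekindDomain.exists_forall_sub_mem_ideal (s := (Finset.univ : Finset (PlacesOver E v)))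
    (fun w => w.1.asIdeal) (fun _ => m) (fun w _ => w.1.prime)
    (fun w _ w' _ hne h => hne (Subtype.ext (HeightOneSpectrum.ext h)))
    (fun w => if (w : PlacesOver E v) = w₀ then 1 else 0)
  -- membership in `𝔭^m` read as a valuation bound in the completion
  have key : ∀ (w : PlacesOver E v) (d : 𝓞 E), d ∈ w.1.asIdeal ^ m →
      Valued.v (algebraMap E (w.1.adicCompletion E) (algebraMap (𝓞 E) E d)) ≤ WithZero.exp (-(m : ℤ)) := by
    intro w d hd
    change Valued.v ((algebraMap (𝓞 E) E d : E) : w.1.adicCompletion E) ≤ _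
    rw [HeightOneSpectrum.valuedAdicCompletion_eq_valuation', HeightOneSpectrum.valuation_of_algebraMap]
    exact (w.1.intValuation_le_pow_iff_mem d m).mpr hd
  refine ⟨y, ?_, fun w hw => ?_⟩
  · have h := hy w₀ (Finset.mem_univ _)
    rw [if_pos rfl] at h
    have := key w₀ (y - 1) h
    rwa [map_sub, map_sub, map_one, map_one] at this
  · have h := hy w (Finset.mem_univ _)
    simp only [if_neg hw, sub_zero] at h
    exact key w y h

variable (E) in
/-- **Weak approximation at the places above `v`**: `E` is dense in `E ⊗_F F_v = ∏_{w ∣ v} E_w`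
(Cassels–Fröhlich II §6; Neukirch II (3.4)). Proof: approximate each component by an element of `E` (density of
`E` in `E_w`) and glue with the Chinese-remainder idempotents of `exists_integer_near_indicator`.
[cite: CasselsFrohlichANT1967, Ch. II §6] -/
theorem denseRange_algebraMap_localRing (v : HeightOneSpectrum (𝓞 F)) :
    DenseRange (algebraMap E (LocalRing E v)) := by
  classical
  intro z
  rw [mem_closure_iff_nhds]
  intro t ht
  rw [nhds_pi, Filter.mem_pi'] at ht
  obtain ⟨I, s, hs, hIs⟩ := ht
  -- (1) a common exponent `n₀` with `{y | v_w(y - z_w) < exp(-n₀)} ⊆ s w` for every `w`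
  choose n hn using fun w : PlacesOver E v => exists_exp_lt_of_mem_nhds w.1 (hs w)
  set n₀ : ℕ := Finset.univ.sup n with hn₀_def
  have hn₀ : ∀ (w : PlacesOver E v) (y : w.1.adicCompletion E),
      Valued.v (y - z w) < WithZero.exp (-(n₀ : ℤ)) → y ∈ s w := fun w y hy =>
    hn w y (lt_of_lt_of_le hy (WithZero.exp_le_exp.mpr (by
      have : n w ≤ n₀ := Finset.le_sup (f := n) (Finset.mem_univ w)
      omega)))
  -- (2) componentwise approximants `e w ∈ E`
  have hC : ∀ w : PlacesOver E v, ∃ e : E,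
      Valued.v (algebraMap E (w.1.adicCompletion E) e - z w) < WithZero.exp (-(n₀ : ℤ)) := by
    intro w
    obtain ⟨π, hπ⟩ := w.1.valuation_exists_uniformizer E
    have hπn : Valued.v (algebraMap E (w.1.adicCompletion E) π ^ n₀) = WithZero.exp (-(n₀ : ℤ)) := by
      rw [map_pow]
      change Valued.v ((π : E) : w.1.adicCompletion E) ^ n₀ = _
      rw [HeightOneSpectrum.valuedAdicCompletion_eq_valuation', hπ, ← WithZero.exp_nsmul, smul_neg,
        nsmul_eq_mul, mul_one]
    have hball := ball_mem_nhds w.1 (z w) (algebraMap E (w.1.adicCompletion E) π ^ n₀)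
      (by rw [hπn]; exact WithZero.exp_ne_zero)
    obtain ⟨e, he⟩ := (HeightOneSpectrum.denseRange_algebraMap (K := E) (v := w.1)).mem_nhds hball
    exact ⟨e, by simpa only [Set.mem_setOf_eq, hπn] using he⟩
  choose e he using hC
  -- (3) a common exponent `m` for the idempotents: `v_{w'}(e w) · exp(-m) < exp(-n₀)` for all `w, w'`
  let f : PlacesOver E v × PlacesOver E v → WithZero (Multiplicative ℤ) := fun p =>
    Valued.v (algebraMap E (p.2.1.adicCompletion E) (e p.1))
  obtain ⟨m, hm⟩ := exists_mul_exp_neg_lt ((Finset.univ : Finset (PlacesOver E v × PlacesOver E v)).image f) n₀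
  have hm' : ∀ w w' : PlacesOver E v,
      Valued.v (algebraMap E (w'.1.adicCompletion E) (e w)) * WithZero.exp (-(m : ℤ)) <
        WithZero.exp (-(n₀ : ℤ)) := fun w w' =>
    hm (f (w, w')) (Finset.mem_image_of_mem f (Finset.mem_univ (w, w')))
  choose y hy₁ hy₂ using fun w₀ : PlacesOver E v => exists_integer_near_indicator v w₀ m
  -- (4) the global element `x = ∑_w e_w y_w`
  refine ⟨algebraMap E (LocalRing E v) (∑ w, e w * algebraMap (𝓞 E) E (y w)), hIs ?_, ⟨_, rfl⟩⟩
  refine Set.mem_pi.mpr fun w' _ => hn₀ w' _ ?_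
  change Valued.v (algebraMap E (w'.1.adicCompletion E) (∑ w, e w * algebraMap (𝓞 E) E (y w)) - z w') < _
  have hsplit : algebraMap E (w'.1.adicCompletion E) (∑ w, e w * algebraMap (𝓞 E) E (y w)) - z w' =
      (algebraMap E (w'.1.adicCompletion E) (e w') - z w') +
        algebraMap E (w'.1.adicCompletion E) (e w') *
          (algebraMap E (w'.1.adicCompletion E) (algebraMap (𝓞 E) E (y w')) - 1) +
        ∑ w ∈ Finset.univ.erase w',
          algebraMap E (w'.1.adicCompletion E) (e w) *
            algebraMap E (w'.1.adicCompletion E) (algebraMap (𝓞 E) E (y w)) := by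
    rw [← Finset.add_sum_erase _ _ (Finset.mem_univ w'), map_add, map_sum]
    simp only [map_mul]
    ring
  rw [hsplit]
  refine Valuation.map_add_lt _ (Valuation.map_add_lt _ (he w') ?_)
    (Valuation.map_sum_lt _ WithZero.exp_ne_zero fun w hw => ?_)
  · rw [map_mul]
    exact lt_of_le_of_lt (mul_le_mul_right (hy₁ w') _) (hm' w' w')
  · rw [map_mul]
    exact lt_of_le_of_lt (mul_le_mul_right (hy₂ w w' (Finset.ne_of_mem_erase hw).symm) _) (hm' w w')

/-- Pointwise form of weak approximation: simultaneous approximation at the places above `v` to any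
precision `q_w^{-n}`. [folklore] -/
theorem exists_forall_valued_sub_lt (v : HeightOneSpectrum (𝓞 F)) (z : LocalRing E v) (n : ℕ) :
    ∃ x : E, ∀ w : PlacesOver E v,
      Valued.v (algebraMap E (w.1.adicCompletion E) x - z w) < WithZero.exp (-(n : ℤ)) := by
  classical
  -- the box `∏_w {y | v_w(y - z_w) < exp(-n)}` is a neighbourhood of `z`
  have hbox : {x : LocalRing E v | ∀ w, Valued.v (x w - z w) < WithZero.exp (-(n : ℤ))} ∈ 𝓝 z := by
    have : {x : LocalRing E v | ∀ w, Valued.v (x w - z w) < WithZero.exp (-(n : ℤ))} =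
        Set.pi Set.univ fun w => {y : w.1.adicCompletion E | Valued.v (y - z w) < WithZero.exp (-(n : ℤ))} := by
      ext x; simp only [Set.mem_setOf_eq, Set.mem_pi, Set.mem_univ, forall_const]
    rw [this]
    refine set_pi_mem_nhds Set.finite_univ fun w _ => ?_
    obtain ⟨π, hπ⟩ := w.1.valuation_exists_uniformizer E
    have hπn : Valued.v (algebraMap E (w.1.adicCompletion E) π ^ n) = WithZero.exp (-(n : ℤ)) := by
      rw [map_pow]
      change Valued.v ((π : E) : w.1.adicCompletion E) ^ n = _
      rw [HeightOneSpectrum.valuedAdicCompletion_eq_valuation', hπ, ← WithZero.exp_nsmul, smul_neg,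
        nsmul_eq_mul, mul_one]
    rw [← hπn]
    exact ball_mem_nhds w.1 (z w) _ (by rw [hπn]; exact WithZero.exp_ne_zero)
  obtain ⟨x, hx⟩ := (denseRange_algebraMap_localRing E v).mem_nhds hbox
  exact ⟨x, hx⟩

end WeakApproximation

/-! ## 3. The conjugation `σ ⊗ 1` is `F_v`-linear -/

section Conj

variable {E}
variable (σ : E ≃ₐ[F] E)

/-- Transport along `σ` intertwines the structure maps: `σ_w ∘ ι_w = ι_{σ w}` (both are continuous and agree
on the dense subfield `F`). [folklore] -/
theorem galAdicCompletionMap_comp_toPlace {v : HeightOneSpectrum (𝓞 F)} (w w' : PlacesOver E v)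
    (h : σ • w.1 = w'.1) : (galAdicCompletionMap σ h).comp (toPlace v w) = toPlace v w' := by
  have key : (fun y => galAdicCompletionMap σ h (toPlace v w y)) = fun y => toPlace v w' y :=
    HeightOneSpectrum.adicCompletion.ext_of_coe F v
      ((continuous_galAdicCompletionMap E σ h).comp (continuous_toPlace v w)) (continuous_toPlace v w')
      (fun x => by simp only [toPlace_coe, galAdicCompletionMap_algebraMap])
  exact RingHom.ext fun y => congrFun key y

/-- Pointwise form of `galAdicCompletionMap_comp_toPlace`. [folklore] -/
@[simp] theorem galAdicCompletionMap_toPlace {v : HeightOneSpectrum (𝓞 F)} (w w' : PlacesOver E v)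
    (h : σ • w.1 = w'.1) (y : v.adicCompletion F) :
    galAdicCompletionMap σ h (toPlace v w y) = toPlace v w' y :=
  RingHom.congr_fun (galAdicCompletionMap_comp_toPlace σ w w' h) y

/-- **`σ ⊗ 1` fixes `ι_v(F_v)`** (`conjLocal` is `F_v`-linear). [folklore] -/
@[simp] theorem conjLocal_toLocalRing (v : HeightOneSpectrum (𝓞 F)) (a : v.adicCompletion F) :
    conjLocal E σ v (toLocalRing E v a) = toLocalRing E v a := by
  funext w
  rw [conjLocal_apply, toLocalRing_apply, toLocalRing_apply]
  exact galAdicCompletionMap_toPlace σ ⟨σ⁻¹ • w.1, under_inv_smul_eq σ w⟩ w (smul_inv_smul σ w.1) a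

/-- `σ ⊗ 1` commutes with the `F_v`-scalars. [folklore] -/
theorem conjLocal_smul (v : HeightOneSpectrum (𝓞 F)) (a : v.adicCompletion F) (x : LocalRing E v) :
    conjLocal E σ v (a • x) = a • conjLocal E σ v x := by
  rw [smul_localRing_def, smul_localRing_def, map_mul, conjLocal_toLocalRing]

/-- **`σ ⊗ 1` is `σ` on `E`**: `(σ ⊗ 1)(e ⊗ 1) = σ e ⊗ 1`. [folklore] -/
@[simp] theorem conjLocal_algebraMap (v : HeightOneSpectrum (𝓞 F)) (e : E) :
    conjLocal E σ v (algebraMap E (LocalRing E v) e) = algebraMap E (LocalRing E v) (σ e) := by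
  funext w
  rw [conjLocal_apply]
  change galAdicCompletionMap σ _ ((e : E) : ((⟨σ⁻¹ • w.1, under_inv_smul_eq σ w⟩ : PlacesOver E v)).1.adicCompletion E) =
    ((σ e : E) : w.1.adicCompletion E)
  rw [galAdicCompletionMap_coe, AlgEquiv.smul_def]

end Conj

/-! ## 4. The quadratic case: `E ⊗_F F_v = F_v ⊕ F_v δ` -/

section Quadratic

/-- The `F_v`-linear map `Ψ_v : F_v × F_v → ∏_{w ∣ v} E_w`, `(a, b) ↦ ι_v a + ι_v b · δ`
(`= a • 1 + b • (δ ⊗ 1)`). [folklore] -/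
def quadraticLocalMap (v : HeightOneSpectrum (𝓞 F)) (δ : E) :
    (v.adicCompletion F × v.adicCompletion F) →ₗ[v.adicCompletion F] LocalRing E v :=
  (LinearMap.fst _ _ _).smulRight (1 : LocalRing E v) +
    (LinearMap.snd _ _ _).smulRight (algebraMap E (LocalRing E v) δ)

/-- `Ψ_v (a, b) = ι_v a + ι_v b · δ`. [folklore] -/
theorem quadraticLocalMap_apply (v : HeightOneSpectrum (𝓞 F)) (δ : E) (p : v.adicCompletion F × v.adicCompletion F) :
    quadraticLocalMap E v δ p = toLocalRing E v p.1 + toLocalRing E v p.2 * algebraMap E (LocalRing E v) δ := by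
  simp only [quadraticLocalMap, LinearMap.add_apply, LinearMap.smulRight_apply, LinearMap.fst_apply,
    LinearMap.snd_apply, smul_localRing_def, mul_one]

/-- `Ψ_v` is continuous. [folklore] -/
theorem continuous_quadraticLocalMap (v : HeightOneSpectrum (𝓞 F)) (δ : E) :
    Continuous (quadraticLocalMap E v δ) := by
  have : (quadraticLocalMap E v δ : (v.adicCompletion F × v.adicCompletion F) → LocalRing E v) =
      fun p => toLocalRing E v p.1 + toLocalRing E v p.2 * algebraMap E (LocalRing E v) δ :=
    funext (quadraticLocalMap_apply E v δ)
  rw [this]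
  exact ((continuous_toLocalRing E v).comp continuous_fst).add
    (((continuous_toLocalRing E v).comp continuous_snd).mul continuous_const)

/-- `Ψ_v` on `E = F ⊕ F δ`: `Ψ_v (x, y) = (x + y δ) ⊗ 1` for `x, y ∈ F`. [folklore] -/
theorem quadraticLocalMap_coe (v : HeightOneSpectrum (𝓞 F)) (δ : E) (x y : F) :
    quadraticLocalMap E v δ ((x : v.adicCompletion F), (y : v.adicCompletion F)) =
      algebraMap E (LocalRing E v) (algebraMap F E x + algebraMap F E y * δ) := by
  rw [quadraticLocalMap_apply, toLocalRing_coe, toLocalRing_coe, map_add, map_mul]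

omit [NumberField F] in
/-- `δ ∉ F` when `σ δ = -δ ≠ 0`. [folklore] -/
theorem not_mem_range_algebraMap_of_apply_eq_neg (σ : E ≃ₐ[F] E) {δ : E} (hσδ : σ δ = -δ) (hδ : δ ≠ 0) :
    δ ∉ Set.range (algebraMap F E) := by
  rintro ⟨x, rfl⟩
  rw [AlgEquiv.commutes] at hσδ
  apply hδ
  have h2 : algebraMap F E x + algebraMap F E x = 0 := eq_neg_iff_add_eq_zero.mp hσδ
  exact add_self_eq_zero.mp h2

/-- `E = F ⊕ F δ` for a quadratic `E/F` and `δ ∉ F`. [folklore] -/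
theorem exists_eq_add_mul_of_isQuadraticExtension [Algebra.IsQuadraticExtension F E] {δ : E}
    (hδF : δ ∉ Set.range (algebraMap F E)) (e : E) :
    ∃ x y : F, e = algebraMap F E x + algebraMap F E y * δ := by
  have hli : LinearIndependent F ![(1 : E), δ] := by
    refine LinearIndependent.pair_iff.mpr fun s t hst => ?_
    by_cases ht : t = 0
    · subst ht
      simp only [zero_smul, add_zero, smul_eq_zero, one_ne_zero, or_false] at hst
      exact ⟨hst, rfl⟩
    · exfalso
      apply hδF
      refine ⟨-(s / t), ?_⟩
      have hst' : algebraMap F E s + algebraMap F E t * δ = 0 := by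
        simpa only [Algebra.smul_def, mul_one] using hst
      have htE : algebraMap F E t ≠ 0 := (map_ne_zero _).mpr ht
      rw [map_neg, map_div₀, neg_eq_iff_eq_neg, div_eq_iff htE]
      linear_combination hst'
  have hcard : Fintype.card (Fin 2) = Module.finrank F E := by
    rw [Fintype.card_fin, Algebra.IsQuadraticExtension.finrank_eq_two]
  set b := basisOfLinearIndependentOfCardEqFinrank hli hcard with hb
  refine ⟨b.repr e 0, b.repr e 1, ?_⟩
  have hsum := b.sum_repr e
  rw [Fin.sum_univ_two] at hsum
  have hb0 : b 0 = 1 := by rw [hb, coe_basisOfLinearIndependentOfCardEqFinrank]; rfl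
  have hb1 : b 1 = δ := by rw [hb, coe_basisOfLinearIndependentOfCardEqFinrank]; rfl
  rw [hb0, hb1, Algebra.smul_def, Algebra.smul_def, mul_one] at hsum
  exact hsum.symm

/-- **Injectivity of `Ψ_v`** — `ι_v a + ι_v b · δ = 0 ⟹ a = b = 0`: apply `σ ⊗ 1`, which fixes `ι_v(F_v)` and
negates `δ`; then `2 ι_v a = 0` and `2 ι_v b · δ = 0` with `δ` a unit. [folklore] -/
theorem quadraticLocalMap_injective (v : HeightOneSpectrum (𝓞 F)) (σ : E ≃ₐ[F] E) {δ : E} (hσδ : σ δ = -δ)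
    (hδ : δ ≠ 0) : Function.Injective (quadraticLocalMap E v δ) := by
  haveI : CharZero (v.adicCompletion F) :=
    charZero_of_injective_algebraMap (algebraMap F (v.adicCompletion F)).injective
  rw [injective_iff_map_eq_zero]
  rintro ⟨a, b⟩ h
  rw [quadraticLocalMap_apply] at h
  have h' := congrArg (conjLocal E σ v) h
  rw [map_add, map_mul, map_zero, conjLocal_toLocalRing, conjLocal_toLocalRing, conjLocal_algebraMap, hσδ,
    map_neg] at h'
  have ha : toLocalRing E v (a + a) = toLocalRing E v 0 := by
    rw [map_add, map_zero]; linear_combination h + h'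
  have hb : toLocalRing E v (b + b) * algebraMap E (LocalRing E v) δ = 0 := by
    rw [map_add]; linear_combination h - h'
  have hδu : IsUnit (algebraMap E (LocalRing E v) δ) := (IsUnit.mk0 δ hδ).map _
  rw [hδu.mul_left_eq_zero, ← map_zero (toLocalRing E v)] at hb
  have ha' := add_self_eq_zero.mp (toLocalRing_injective E v ha)
  have hb' := add_self_eq_zero.mp (toLocalRing_injective E v hb)
  simp only [ha', hb', Prod.mk_zero_zero]

open scoped Valued in
/-- **Surjectivity of `Ψ_v`** for quadratic `E/F`: the range of `Ψ_v` is a finite-dimensional, hence closed,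
`F_v`-subspace of the Hausdorff topological `F_v`-vector space `∏ E_w`, and it contains the image of
`E = F ⊕ F δ`, which is dense (weak approximation). [folklore] -/
theorem quadraticLocalMap_surjective [Algebra.IsQuadraticExtension F E] (v : HeightOneSpectrum (𝓞 F))
    {δ : E} (hδF : δ ∉ Set.range (algebraMap F E)) : Function.Surjective (quadraticLocalMap E v δ) := by
  set Ψ := quadraticLocalMap E v δ with hΨ
  have hclosed : IsClosed (Set.range Ψ) := by
    change IsClosed ((LinearMap.range Ψ : Submodule (v.adicCompletion F) (LocalRing E v)) : Set (LocalRing E v))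
    exact Submodule.closed_of_finiteDimensional (𝕜 := v.adicCompletion F) (E := LocalRing E v) (LinearMap.range Ψ)
  have hE : ∀ e : E, algebraMap E (LocalRing E v) e ∈ Set.range Ψ := fun e => by
    obtain ⟨x, y, rfl⟩ := exists_eq_add_mul_of_isQuadraticExtension E hδF e
    exact ⟨((x : v.adicCompletion F), (y : v.adicCompletion F)), quadraticLocalMap_coe E v δ x y⟩
  have hdense : Dense (Set.range Ψ) :=
    (denseRange_algebraMap_localRing E v).mono (Set.range_subset_iff.mpr hE)
  intro z
  have hz : z ∈ Set.range Ψ := by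
    rw [← hclosed.closure_eq, hdense.closure_eq]
    exact Set.mem_univ z
  exact hz

/-- **`E ⊗_F F_v = F_v ⊕ F_v δ`**: for a quadratic extension `E/F` of number fields, `σ ∈ Aut(E/F)` and `δ ∈ E`
with `σ δ = -δ ≠ 0`, the map `(a, b) ↦ ι_v a + ι_v b · δ` is an isomorphism of topological `F_v`-modules
`F_v × F_v ≃ ∏_{w ∣ v} E_w` (Cassels–Fröhlich II §10: `L ⊗_K K_v ≅ ∏_{w ∣ v} L_w`, quadratic case).
[cite: CasselsFrohlichANT1967, Ch. II §10] -/
def quadraticLocalEquiv [Algebra.IsQuadraticExtension F E] (v : HeightOneSpectrum (𝓞 F)) (σ : E ≃ₐ[F] E)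
    {δ : E} (hσδ : σ δ = -δ) (hδ : δ ≠ 0) :
    (v.adicCompletion F × v.adicCompletion F) ≃L[v.adicCompletion F] LocalRing E v :=
  open scoped Valued in
  (LinearEquiv.ofBijective (quadraticLocalMap E v δ)
    ⟨quadraticLocalMap_injective E v σ hσδ hδ,
      quadraticLocalMap_surjective E v (not_mem_range_algebraMap_of_apply_eq_neg E σ hσδ hδ)⟩).toContinuousLinearEquiv

/-- `quadraticLocalEquiv` is `Ψ_v`. [folklore] -/
@[simp] theorem quadraticLocalEquiv_apply [Algebra.IsQuadraticExtension F E] (v : HeightOneSpectrum (𝓞 F))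
    (σ : E ≃ₐ[F] E) {δ : E} (hσδ : σ δ = -δ) (hδ : δ ≠ 0) (p : v.adicCompletion F × v.adicCompletion F) :
    quadraticLocalEquiv E v σ hσδ hδ p = toLocalRing E v p.1 + toLocalRing E v p.2 * algebraMap E (LocalRing E v) δ :=
  quadraticLocalMap_apply E v δ p

/-- Every element of `E ⊗_F F_v` is uniquely `ι_v a + ι_v b · δ`. [folklore] -/
theorem existsUnique_eq_add_mul [Algebra.IsQuadraticExtension F E] (v : HeightOneSpectrum (𝓞 F)) (σ : E ≃ₐ[F] E)
    {δ : E} (hσδ : σ δ = -δ) (hδ : δ ≠ 0) (x : LocalRing E v) :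
    ∃! p : v.adicCompletion F × v.adicCompletion F,
      x = toLocalRing E v p.1 + toLocalRing E v p.2 * algebraMap E (LocalRing E v) δ := by
  refine ⟨(quadraticLocalEquiv E v σ hσδ hδ).symm x, ?_, fun p hp => ?_⟩
  · change x = _
    rw [← quadraticLocalEquiv_apply E v σ hσδ hδ, ContinuousLinearEquiv.apply_symm_apply]
  · change x = _ at hp
    rw [← quadraticLocalEquiv_apply E v σ hσδ hδ] at hp
    rw [hp, ContinuousLinearEquiv.symm_apply_apply]

/-- **`[E ⊗_F F_v : F_v] = 2`** (`= [E : F]`): the local degree formula in the quadratic case. [folklore] -/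
theorem finrank_localRing_eq_two [Algebra.IsQuadraticExtension F E] (v : HeightOneSpectrum (𝓞 F)) (σ : E ≃ₐ[F] E)
    {δ : E} (hσδ : σ δ = -δ) (hδ : δ ≠ 0) : Module.finrank (v.adicCompletion F) (LocalRing E v) = 2 := by
  rw [← (quadraticLocalEquiv E v σ hσδ hδ).toLinearEquiv.finrank_eq, Module.finrank_prod, Module.finrank_self]

/-- `E ⊗_F F_v` is a finite free `F_v`-module (quadratic case). [folklore] -/
theorem finite_localRing [Algebra.IsQuadraticExtension F E] (v : HeightOneSpectrum (𝓞 F)) (σ : E ≃ₐ[F] E)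
    {δ : E} (hσδ : σ δ = -δ) (hδ : δ ≠ 0) : Module.Finite (v.adicCompletion F) (LocalRing E v) :=
  Module.Finite.equiv (quadraticLocalEquiv E v σ hσδ hδ).toLinearEquiv

/-- A quadratic extension of number fields has an automorphism `σ` and an element `δ ≠ 0` with
`σ δ = -δ` (`E/F` is Galois of order `2`; `δ = e - σ e`). [folklore] -/
theorem exists_algEquiv_apply_eq_neg [Algebra.IsQuadraticExtension F E] :
    ∃ (σ : E ≃ₐ[F] E) (δ : E), σ δ = -δ ∧ δ ≠ 0 := by
  haveI : FiniteDimensional F E :=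
    Module.finite_of_finrank_eq_succ (Algebra.IsQuadraticExtension.finrank_eq_two F E)
  haveI : PerfectField F := inferInstance
  haveI : Algebra.IsAlgebraic F E := inferInstance
  haveI : Algebra.IsSeparable F E := inferInstance
  haveI : IsGalois F E := Algebra.IsQuadraticExtension.isGalois F E
  have hcard : Nat.card (E ≃ₐ[F] E) = 2 := by
    rw [IsGalois.card_aut_eq_finrank, Algebra.IsQuadraticExtension.finrank_eq_two]
  obtain ⟨σ, hσ⟩ : ∃ σ : E ≃ₐ[F] E, σ ≠ 1 := by
    by_contra h
    push Not at h
    have h1 : Nat.card (E ≃ₐ[F] E) ≤ 1 :=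
      Finite.card_le_one_iff_subsingleton.mpr ⟨fun a b => by rw [h a, h b]⟩
    omega
  obtain ⟨e, he⟩ : ∃ e : E, σ e ≠ e := by
    by_contra h
    push Not at h
    exact hσ (AlgEquiv.ext h)
  have hσ2 : σ * σ = 1 := by
    have h := pow_card_eq_one' (x := σ)
    rwa [hcard, pow_two] at h
  refine ⟨σ, e - σ e, ?_, sub_ne_zero.mpr (Ne.symm he)⟩
  rw [map_sub, neg_sub, ← AlgEquiv.mul_apply, hσ2, AlgEquiv.one_apply]

/-- **`[E ⊗_F F_v : F_v] = [E : F] = 2`** for every quadratic extension of number fields and every finite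
place `v` (parameter-free form). [folklore] -/
theorem finrank_localRing [Algebra.IsQuadraticExtension F E] (v : HeightOneSpectrum (𝓞 F)) :
    Module.finrank (v.adicCompletion F) (LocalRing E v) = 2 := by
  obtain ⟨σ, δ, hσδ, hδ⟩ := exists_algEquiv_apply_eq_neg (F := F) (E := E)
  exact finrank_localRing_eq_two E v σ hσδ hδ

/-- `E ⊗_F F_v` is a finite `F_v`-module (quadratic case, instance). [folklore] -/
instance moduleFinite_localRing [Algebra.IsQuadraticExtension F E] (v : HeightOneSpectrum (𝓞 F)) :
    Module.Finite (v.adicCompletion F) (LocalRing E v) := by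
  obtain ⟨σ, δ, hσδ, hδ⟩ := exists_algEquiv_apply_eq_neg (F := F) (E := E)
  exact finite_localRing E v σ hσδ hδ

/-- **`E ⊗_F F_v` is a quadratic extension of `F_v`** (free of rank `2`): the carrier
`GL_n(E ⊗_F F_v) = GL_n(∏_{w ∣ v} E_w)` is the group of `F_v`-points of `Res_{E/F} GL_n`. [folklore] -/
instance isQuadraticExtension_localRing [Algebra.IsQuadraticExtension F E] (v : HeightOneSpectrum (𝓞 F)) :
    Algebra.IsQuadraticExtension (v.adicCompletion F) (LocalRing E v) where
  finrank_eq_two' := finrank_localRing E v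

/-- **`σ ⊗ 1` in coordinates**: `(σ ⊗ 1)(ι_v a + ι_v b · δ) = ι_v a - ι_v b · δ`. [folklore] -/
theorem conjLocal_quadraticLocalEquiv [Algebra.IsQuadraticExtension F E] (v : HeightOneSpectrum (𝓞 F))
    (σ : E ≃ₐ[F] E) {δ : E} (hσδ : σ δ = -δ) (hδ : δ ≠ 0) (a b : v.adicCompletion F) :
    conjLocal E σ v (quadraticLocalEquiv E v σ hσδ hδ (a, b)) = quadraticLocalEquiv E v σ hσδ hδ (a, -b) := by
  rw [quadraticLocalEquiv_apply, quadraticLocalEquiv_apply, map_add, map_mul, conjLocal_toLocalRing,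
    conjLocal_toLocalRing, conjLocal_algebraMap, hσδ, map_neg, map_neg]
  ring

/-- **Multiplication by `δ` in coordinates**: `δ · (ι_v a + ι_v b · δ) = ι_v (d b) + ι_v a · δ` where
`δ² = d ∈ F`. [folklore] -/
theorem algebraMap_mul_quadraticLocalEquiv [Algebra.IsQuadraticExtension F E] (v : HeightOneSpectrum (𝓞 F))
    (σ : E ≃ₐ[F] E) {δ : E} (hσδ : σ δ = -δ) (hδ : δ ≠ 0) {d : F} (hd : δ * δ = algebraMap F E d)
    (a b : v.adicCompletion F) :
    algebraMap E (LocalRing E v) δ * quadraticLocalEquiv E v σ hσδ hδ (a, b) =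
      quadraticLocalEquiv E v σ hσδ hδ ((d : v.adicCompletion F) * b, a) := by
  rw [quadraticLocalEquiv_apply, quadraticLocalEquiv_apply]
  dsimp only
  rw [map_mul (toLocalRing E v), toLocalRing_coe, ← hd, map_mul (algebraMap E (LocalRing E v))]
  ring

end Quadratic

end UnitaryGroup

end Literature.NumberTheory.Automorphic

end
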